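import Mathlib
import HarnessLib
import Summits.HubbardSuperconductivity.HubbardSuperconductivity.Theorems.KLProgrammeKLRegimeTwoVolumeSubstitutionGluingBound

/-!
# Route `KLProgramme` — crux K3, the nested two-volume pass: the substitution–gluing defect AT A DEEP PIN, part 2 — the WINDING lifts (T3)
# (the SUMMED form of bracket (iv), continued) (cell gate-hubbard-kl, seat hubbard-kl-k3c4-p1 g8; VL-STUB-ROUTE-A-g8.md §3,
# plan (R51); `--supports` stmt-…-20440)

`…TwoVolumeSubstitutionGluing.norm_kernel_map_glue_sub_glue_map_le` (p547014) bounds the kernels of `map T′ (Glue V) − Glue (map T V)` at an out-string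
`X′` by `Σ_Y ‖kernel V Y‖ · (T2 + T1 + T3)`: other-block lifts `T2 = Σ_{β ≠ β₀} ∏_i B(X′_i, β, Y_i)`, cross-block out-strings
`T1 = [X′ ⊄ β₀]·∏_i B(X′_i, β₀, Y_i)`, winding lifts `T3 = [X′ ⊂ β₀]·Σ_{βs ≠ const β₀} ∏_i B(X′_i, βs i, Y_i)`, with `B(x′, β, y) = ‖T′ x′ (e₁⁻¹(β, y))‖`
and `β₀` the block of the reference leg.  This file sums the three terms over the out-strings PINNED at a DEEP out-label `w′` (block `β₀`), for an
abstract nonnegative `B : Γ₂′ → ι → Γ₁ → ℝ`, block map `box : Γ₂′ → ι`, nonnegative in-string weights `k` (the `‖kernel V (n+1) ·‖`), and the data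

* column sums `Σ_{x′} B x′ β y ≤ a`, box-collapsed column sums `Σ_β Σ_{x′ ∈ β₀} B x′ β y ≤ a` (translation covariance), pin row in its box `Σ_y B w′ β₀ y ≤ a`;
* TAILS (all `≤ τ`): the pin's row outside its box `Σ_{β ≠ β₀} Σ_y B w′ β y`, the pin's row beyond the near region `Σ_{¬Near y} B w′ β₀ y`, and, for in-labels
  `y` OFF the zone `Z` (deep in block `β₀`), the column outside the box `Σ_{x′ ∉ β₀} B x′ β₀ y` and the winding columns `Σ_{β ≠ β₀} Σ_{x′ ∈ β₀} B x′ β y`;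
* geometry: a near in-label and a zone in-label are `Far`; profiles: pinned `Σ_{Y : Y_p = y} k Y ≤ N`, far `Σ_{Y : Y_p = y, Far (Y_p) (Y_i)} k Y ≤ Nfar`:

`(T2)`, `(T1)` and the helpers are in `…TwoVolumeSubstitutionGluingBound`; here **`sum_pinned_winding_le`** `(T3) ≤ aⁿ·τ·N + n·aⁿ·(3τN + a·Nfar)`.
Everything is proved; no definition; model-free.
References: Salmhofer 1999 §2.6/§4.3 (finite-volume bookkeeping); BGM 2006 §2.7 (2.70)–(2.71a).
-/

noncomputable section

namespace Summit.HubbardSuperconductivity.HubbardSuperconductivity.Theorems.TwoVolumeDefect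

set_option linter.dupNamespace false -- summit = problem name (single-conjunct summit), D-0017

open Finset Literature.MathematicalPhysics.QuantumLattice

section Generic

variable {ι Γ₁ Γ₂' : Type*} [Fintype ι] [DecidableEq ι] [Fintype Γ₁] [DecidableEq Γ₁] [Fintype Γ₂'] [DecidableEq Γ₂']

/-! ## §4 (T3): winding lifts -/

/-- **(T3) WINDING LIFTS at a deep pin.**  All out-legs in the block `β₀`, the in-legs lifted to blocks `βs ≠ const β₀`: if the pin's in-leg is lifted to
another block the pinned factor is the pin's row outside its box (`≤ τ`); otherwise some leg `j ≠ p` is lifted to `βs j ≠ β₀` and its factor is a WINDING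
column `Σ_{β ≠ β₀} Σ_{x′ ∈ β₀} B x′ β (Y_j)` — a tail if `Y_j` is deep, else the zone alternative of (T1) (box-collapsed column sums `≤ a` by translation
covariance): `Σ_{X′ : X′_p = w′} Σ_Y k(Y)·[X′ ⊂ β₀]·Σ_{βs ≠ const β₀} ∏_i B(X′_i, βs i, Y_i) ≤ aⁿ·τ·N + n·aⁿ·(3τN + a·Nfar)`. [folklore] -/
theorem sum_pinned_winding_le {n : ℕ} (B : Γ₂' → ι → Γ₁ → ℝ) (hB : ∀ x β y, 0 ≤ B x β y) (k : (Fin (n + 1) → Γ₁) → ℝ)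
    (hk : ∀ Y, 0 ≤ k Y) (p : Fin (n + 1)) (w' : Γ₂') (box : Γ₂' → ι) (β₀ : ι) (hw : box w' = β₀)
    (Z Near : Γ₁ → Prop) [DecidablePred Z] [DecidablePred Near] (Far : Γ₁ → Γ₁ → Prop) [DecidableRel Far]
    (hZ : ∀ y y', Near y → Z y' → Far y y')
    {a τ N Nfar : ℝ} (ha : 0 ≤ a) (hτ0 : 0 ≤ τ) (hN0 : 0 ≤ N) (hNfar0 : 0 ≤ Nfar)
    (hwin : ∀ β' y, ∑ β, ∑ x ∈ univ.filter (fun x : Γ₂' => box x = β'), B x β y ≤ a) (hρ : ∑ y, B w' β₀ y ≤ a)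
    (hτ₂ : ∑ β ∈ univ.erase β₀, ∑ y, B w' β y ≤ τ)
    (hτ₃ : ∑ y ∈ univ.filter (fun y : Γ₁ => ¬ Near y), B w' β₀ y ≤ τ)
    (hτ₄ : ∀ y, ¬ Z y → ∑ β ∈ univ.erase β₀, ∑ x ∈ univ.filter (fun x : Γ₂' => box x = β₀), B x β y ≤ τ)
    (hN : ∀ y, ∑ Y ∈ univ.filter (fun Y : Fin (n + 1) → Γ₁ => Y p = y), k Y ≤ N)
    (hNfar : ∀ y (i : Fin (n + 1)), ∑ Y ∈ univ.filter (fun Y : Fin (n + 1) → Γ₁ => Y p = y ∧ Far (Y p) (Y i)), k Y ≤ Nfar) :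
    ∑ X' ∈ univ.filter (fun X' : Fin (n + 1) → Γ₂' => X' p = w'), ∑ Y : Fin (n + 1) → Γ₁,
        k Y * (if ∀ i, box (X' i) = β₀ then ∑ βs ∈ univ.erase (fun _ : Fin (n + 1) => β₀), ∏ i, B (X' i) (βs i) (Y i) else 0) ≤
      a ^ n * τ * N + n * a ^ n * (3 * τ * N + a * Nfar) := by
  classical
  set Xp := univ.filter (fun X' : Fin (n + 1) → Γ₂' => X' p = w') with hXp
  -- in-box columns of the in-leg `y` lifted to block `β`
  set G : ι → Γ₁ → ℝ := fun β y => ∑ x ∈ univ.filter (fun x : Γ₂' => box x = β₀), B x β y with hG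
  have hG0 : ∀ β y, 0 ≤ G β y := fun β y => sum_nonneg fun x _ => hB _ _ _
  have hGall : ∀ y, ∑ β, G β y ≤ a := fun y => hwin β₀ y
  have hGa : ∀ y, ∑ β ∈ univ.erase β₀, G β y ≤ a := fun y =>
    (sum_le_sum_of_subset_of_nonneg (erase_subset _ _) fun β _ _ => hG0 β y).trans (hGall y)
  have hwindb : ∀ y, ∑ β ∈ univ.erase β₀, G β y ≤ τ + (if Z y then a else 0) := by
    intro y
    by_cases hz : Z y
    · rw [if_pos hz]; exact (hGa y).trans (by linarith)
    · rw [if_neg hz, add_zero]; exact hτ₄ y hz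
  have hzone : ∀ (y y' : Γ₁), (if Z y' then a else 0) ≤ (if Near y then 0 else a) + (if Far y y' then a else 0) := by
    intro y y'
    by_cases hz : Z y'
    · rw [if_pos hz]
      by_cases hn : Near y
      · rw [if_pos hn, if_pos (hZ y y' hn hz), zero_add]
      · rw [if_neg hn]
        exact le_add_of_nonneg_right (ite_nonneg ha le_rfl)
    · rw [if_neg hz]
      exact add_nonneg (ite_nonneg le_rfl ha) (ite_nonneg ha le_rfl)
  have hind : ∀ (x : Γ₂') (β : ι) (y : Γ₁), (if box x = β₀ then (1 : ℝ) else 0) * B x β y = if box x = β₀ then B x β y else 0 := by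
    intro x β y; split_ifs <;> simp
  -- Step 1: indicator of the winding set ≤ sum over the offending leg `j`, legs restricted to the box by indicators
  have step1 : ∑ X' ∈ Xp, ∑ Y : Fin (n + 1) → Γ₁,
        k Y * (if ∀ i, box (X' i) = β₀ then ∑ βs ∈ univ.erase (fun _ : Fin (n + 1) => β₀), ∏ i, B (X' i) (βs i) (Y i) else 0) ≤
      ∑ j : Fin (n + 1), ∑ Y : Fin (n + 1) → Γ₁, k Y * ∑ βs ∈ univ.filter (fun βs : Fin (n + 1) → ι => βs j ≠ β₀),
        ∑ X' ∈ Xp, ∏ i, ((if box (X' i) = β₀ then (1 : ℝ) else 0) * B (X' i) (βs i) (Y i)) := by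
    calc ∑ X' ∈ Xp, ∑ Y : Fin (n + 1) → Γ₁,
          k Y * (if ∀ i, box (X' i) = β₀ then ∑ βs ∈ univ.erase (fun _ : Fin (n + 1) => β₀), ∏ i, B (X' i) (βs i) (Y i) else 0)
        ≤ ∑ X' ∈ Xp, ∑ Y : Fin (n + 1) → Γ₁, k Y * ∑ j : Fin (n + 1), ∑ βs ∈ univ.filter (fun βs : Fin (n + 1) → ι => βs j ≠ β₀),
            ∏ i, ((if box (X' i) = β₀ then (1 : ℝ) else 0) * B (X' i) (βs i) (Y i)) := by
          refine sum_le_sum fun X' _ => sum_le_sum fun Y _ => mul_le_mul_of_nonneg_left ?_ (hk Y)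
          have hnn : ∀ βs : Fin (n + 1) → ι, 0 ≤ ∏ i, ((if box (X' i) = β₀ then (1 : ℝ) else 0) * B (X' i) (βs i) (Y i)) :=
            fun βs => prod_nonneg fun i _ => mul_nonneg (by split_ifs <;> norm_num) (hB _ _ _)
          refine le_trans ?_ (sum_erase_const_le_sum_filter _ hnn β₀)
          split_ifs with hall
          · refine le_of_eq (sum_congr rfl fun βs _ => prod_congr rfl fun i _ => ?_)
            rw [if_pos (hall i), one_mul]
          · exact sum_nonneg fun βs _ => hnn βs
      _ = ∑ X' ∈ Xp, ∑ Y : Fin (n + 1) → Γ₁, ∑ j : Fin (n + 1), ∑ βs ∈ univ.filter (fun βs : Fin (n + 1) → ι => βs j ≠ β₀),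
            k Y * ∏ i, ((if box (X' i) = β₀ then (1 : ℝ) else 0) * B (X' i) (βs i) (Y i)) := by
          simp_rw [mul_sum]
      _ = ∑ j : Fin (n + 1), ∑ X' ∈ Xp, ∑ Y : Fin (n + 1) → Γ₁, ∑ βs ∈ univ.filter (fun βs : Fin (n + 1) → ι => βs j ≠ β₀),
            k Y * ∏ i, ((if box (X' i) = β₀ then (1 : ℝ) else 0) * B (X' i) (βs i) (Y i)) := by
          exact (sum_congr rfl fun X' _ => sum_comm).trans sum_comm
      _ = ∑ j : Fin (n + 1), ∑ Y : Fin (n + 1) → Γ₁, ∑ X' ∈ Xp, ∑ βs ∈ univ.filter (fun βs : Fin (n + 1) → ι => βs j ≠ β₀),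
            k Y * ∏ i, ((if box (X' i) = β₀ then (1 : ℝ) else 0) * B (X' i) (βs i) (Y i)) :=
          sum_congr rfl fun j _ => sum_comm
      _ = ∑ j : Fin (n + 1), ∑ Y : Fin (n + 1) → Γ₁, ∑ βs ∈ univ.filter (fun βs : Fin (n + 1) → ι => βs j ≠ β₀), ∑ X' ∈ Xp,
            k Y * ∏ i, ((if box (X' i) = β₀ then (1 : ℝ) else 0) * B (X' i) (βs i) (Y i)) :=
          sum_congr rfl fun j _ => sum_congr rfl fun Y _ => sum_comm
      _ = _ := by
          refine sum_congr rfl fun j _ => sum_congr rfl fun Y _ => ?_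
          rw [mul_sum]
          exact sum_congr rfl fun βs _ => (mul_sum _ _ _).symm
  -- Step 2: the pinned out-sum factorises: pin entry × in-box columns
  have step2 : ∀ (Y : Fin (n + 1) → Γ₁) (βs : Fin (n + 1) → ι),
      ∑ X' ∈ Xp, ∏ i, ((if box (X' i) = β₀ then (1 : ℝ) else 0) * B (X' i) (βs i) (Y i)) =
        B w' (βs p) (Y p) * ∏ i ∈ univ.erase p, G (βs i) (Y i) := by
    intro Y βs
    rw [hXp, sum_pinned_prod_eq (fun i x => (if box x = β₀ then (1 : ℝ) else 0) * B x (βs i) (Y i)) p w',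
      if_pos hw, one_mul]
    congr 1
    refine prod_congr rfl fun i _ => ?_
    simp_rw [hind]
    exact (sum_filter _ _).symm
  -- Step 3: the lift sum factorises leg by leg
  have step3 : ∀ (j : Fin (n + 1)) (Y : Fin (n + 1) → Γ₁),
      ∑ βs ∈ univ.filter (fun βs : Fin (n + 1) → ι => βs j ≠ β₀), B w' (βs p) (Y p) * ∏ i ∈ univ.erase p, G (βs i) (Y i) =
        (∑ b ∈ (if p = j then univ.erase β₀ else univ), B w' b (Y p)) *
          ∏ i ∈ univ.erase p, ∑ b ∈ (if i = j then univ.erase β₀ else univ), G b (Y i) := by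
    intro j Y
    have hset : univ.filter (fun βs : Fin (n + 1) → ι => βs j ≠ β₀) =
        Fintype.piFinset (fun i : Fin (n + 1) => if i = j then univ.erase β₀ else univ) := by
      ext βs
      simp only [mem_filter, mem_univ, true_and, Fintype.mem_piFinset]
      constructor
      · intro h i
        split_ifs with hi
        · subst hi; exact mem_erase.2 ⟨h, mem_univ _⟩
        · exact mem_univ _
      · intro h
        have := h j
        rw [if_pos rfl] at this
        exact (mem_erase.1 this).1
    have hprod : ∀ βs : Fin (n + 1) → ι, B w' (βs p) (Y p) * ∏ i ∈ univ.erase p, G (βs i) (Y i) =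
        ∏ i, (if i = p then B w' (βs i) (Y p) else G (βs i) (Y i)) := by
      intro βs
      rw [← mul_prod_erase univ (fun i => if i = p then B w' (βs i) (Y p) else G (βs i) (Y i)) (mem_univ p)]
      simp only [if_true]
      congr 1
      exact prod_congr rfl fun i hi => by rw [if_neg (mem_erase.1 hi).1]
    simp_rw [hprod]
    rw [hset, ← prod_univ_sum (fun i : Fin (n + 1) => if i = j then univ.erase β₀ else univ)
      (fun i b => if i = p then B w' b (Y p) else G b (Y i)),
      ← mul_prod_erase univ (fun i => ∑ b ∈ (if i = j then univ.erase β₀ else univ), (if i = p then B w' b (Y p) else G b (Y i)))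
        (mem_univ p)]
    simp only [if_true]
    congr 1
    exact prod_congr rfl fun i hi => sum_congr rfl fun b _ => by rw [if_neg (mem_erase.1 hi).1]
  -- Step 4a: the pin leg lifted out of its box (`j = p`)
  have step4a : ∀ Y : Fin (n + 1) → Γ₁,
      (∑ b ∈ (if p = p then univ.erase β₀ else univ), B w' b (Y p)) *
          ∏ i ∈ univ.erase p, ∑ b ∈ (if i = p then univ.erase β₀ else univ), G b (Y i) ≤
        (∑ b ∈ univ.erase β₀, B w' b (Y p)) * a ^ n := by
    intro Y
    rw [if_pos rfl]
    refine mul_le_mul_of_nonneg_left ?_ (sum_nonneg fun b _ => hB _ _ _)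
    calc ∏ i ∈ univ.erase p, ∑ b ∈ (if i = p then univ.erase β₀ else univ), G b (Y i) ≤ a ^ (univ.erase p).card := by
          refine prod_le_pow_card_of_le _ _ (fun i _ => sum_nonneg fun b _ => hG0 _ _) fun i hi => ?_
          rw [if_neg (mem_erase.1 hi).1]
          exact hGall (Y i)
      _ = a ^ n := by rw [card_univ_erase_fin]
  -- Step 4b: another leg `j ≠ p` wound (`βs j ≠ β₀`)
  have step4b : ∀ j ∈ univ.erase p, ∀ Y : Fin (n + 1) → Γ₁,
      (∑ b ∈ (if p = j then univ.erase β₀ else univ), B w' b (Y p)) *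
          ∏ i ∈ univ.erase p, ∑ b ∈ (if i = j then univ.erase β₀ else univ), G b (Y i) ≤
        (B w' β₀ (Y p) * (τ + (if Z (Y j) then a else 0)) + (∑ b ∈ univ.erase β₀, B w' b (Y p)) * a) *
          a ^ ((univ.erase p).erase j).card := by
    intro j hj Y
    have hjp : j ≠ p := (mem_erase.1 hj).1
    rw [if_neg hjp.symm, ← add_sum_erase univ (fun b => B w' b (Y p)) (mem_univ β₀),
      ← mul_prod_erase (univ.erase p) (fun i => ∑ b ∈ (if i = j then univ.erase β₀ else univ), G b (Y i)) hj]
    simp only [if_true]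
    have hrest : ∏ i ∈ (univ.erase p).erase j, ∑ b ∈ (if i = j then univ.erase β₀ else univ), G b (Y i) ≤
        a ^ ((univ.erase p).erase j).card := by
      refine prod_le_pow_card_of_le _ _ (fun i _ => sum_nonneg fun b _ => hG0 _ _) fun i hi => ?_
      rw [if_neg (mem_erase.1 hi).1]
      exact hGall (Y i)
    have hρin0 : 0 ≤ B w' β₀ (Y p) := hB _ _ _
    have hρout0 : 0 ≤ ∑ b ∈ univ.erase β₀, B w' b (Y p) := sum_nonneg fun b _ => hB _ _ _
    have hw0 : 0 ≤ ∑ b ∈ univ.erase β₀, G b (Y j) := sum_nonneg fun b _ => hG0 _ _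
    calc (B w' β₀ (Y p) + ∑ b ∈ univ.erase β₀, B w' b (Y p)) *
          ((∑ b ∈ univ.erase β₀, G b (Y j)) * ∏ i ∈ (univ.erase p).erase j, ∑ b ∈ (if i = j then univ.erase β₀ else univ), G b (Y i))
        = (B w' β₀ (Y p) * ∑ b ∈ univ.erase β₀, G b (Y j) + (∑ b ∈ univ.erase β₀, B w' b (Y p)) * ∑ b ∈ univ.erase β₀, G b (Y j)) *
            ∏ i ∈ (univ.erase p).erase j, ∑ b ∈ (if i = j then univ.erase β₀ else univ), G b (Y i) := by ring
      _ ≤ (B w' β₀ (Y p) * (τ + (if Z (Y j) then a else 0)) + (∑ b ∈ univ.erase β₀, B w' b (Y p)) * a) *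
            a ^ ((univ.erase p).erase j).card :=
          mul_le_mul (add_le_add (mul_le_mul_of_nonneg_left (hwindb (Y j)) hρin0) (mul_le_mul_of_nonneg_left (hGa (Y j)) hρout0))
            hrest (prod_nonneg fun i _ => sum_nonneg fun b _ => hG0 _ _) (by positivity)
  -- Step 5a: sum over `Y` for `j = p`
  have step5a : ∑ Y : Fin (n + 1) → Γ₁, k Y * ((∑ b ∈ univ.erase β₀, B w' b (Y p)) * a ^ n) ≤ a ^ n * τ * N := by
    have h := sum_mul_apply_leg_le k (fun y => ∑ b ∈ univ.erase β₀, B w' b y) (fun y => sum_nonneg fun b _ => hB _ _ _) p hN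
    have hout : ∑ y, ∑ b ∈ univ.erase β₀, B w' b y ≤ τ := by rw [sum_comm]; exact hτ₂
    calc ∑ Y : Fin (n + 1) → Γ₁, k Y * ((∑ b ∈ univ.erase β₀, B w' b (Y p)) * a ^ n)
        = a ^ n * ∑ Y : Fin (n + 1) → Γ₁, k Y * ∑ b ∈ univ.erase β₀, B w' b (Y p) := by
          rw [mul_sum]; exact sum_congr rfl fun Y _ => by ring
      _ ≤ a ^ n * ((∑ y, ∑ b ∈ univ.erase β₀, B w' b y) * N) := mul_le_mul_of_nonneg_left h (pow_nonneg ha n)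
      _ ≤ a ^ n * (τ * N) := mul_le_mul_of_nonneg_left (mul_le_mul_of_nonneg_right hout hN0) (pow_nonneg ha n)
      _ = a ^ n * τ * N := by ring
  -- Step 5b: sum over `Y` for `j ≠ p`
  have step5b : ∀ j ∈ univ.erase p, ∑ Y : Fin (n + 1) → Γ₁, k Y *
      ((B w' β₀ (Y p) * (τ + (if Z (Y j) then a else 0)) + (∑ b ∈ univ.erase β₀, B w' b (Y p)) * a) *
        a ^ ((univ.erase p).erase j).card) ≤
      a ^ ((univ.erase p).erase j).card * (τ * a * N + a * τ * N + a * a * Nfar + a * τ * N) := by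
    intro j hj
    have hsplit : ∀ Y : Fin (n + 1) → Γ₁, k Y *
        ((B w' β₀ (Y p) * (τ + (if Z (Y j) then a else 0)) + (∑ b ∈ univ.erase β₀, B w' b (Y p)) * a) *
          a ^ ((univ.erase p).erase j).card) ≤
        a ^ ((univ.erase p).erase j).card *
          (τ * (k Y * B w' β₀ (Y p)) + (k Y * (B w' β₀ (Y p) * (if Near (Y p) then 0 else a))) +
            a * ((if Far (Y p) (Y j) then k Y else 0) * B w' β₀ (Y p)) +
            a * (k Y * ∑ b ∈ univ.erase β₀, B w' b (Y p))) := by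
      intro Y
      have h1 := hzone (Y p) (Y j)
      have hkB : 0 ≤ k Y * B w' β₀ (Y p) := mul_nonneg (hk Y) (hB _ _ _)
      have hfar : (if Far (Y p) (Y j) then k Y else 0) * B w' β₀ (Y p) = k Y * B w' β₀ (Y p) * (if Far (Y p) (Y j) then 1 else 0) := by
        by_cases h : Far (Y p) (Y j) <;> simp [h]
      rw [hfar]
      have : k Y * ((B w' β₀ (Y p) * (τ + (if Z (Y j) then a else 0)) + (∑ b ∈ univ.erase β₀, B w' b (Y p)) * a) *
            a ^ ((univ.erase p).erase j).card) =
          a ^ ((univ.erase p).erase j).card *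
            ((k Y * B w' β₀ (Y p)) * (τ + (if Z (Y j) then a else 0)) + a * (k Y * ∑ b ∈ univ.erase β₀, B w' b (Y p))) := by ring
      rw [this]
      refine mul_le_mul_of_nonneg_left (add_le_add ?_ le_rfl) (pow_nonneg ha _)
      have h2 : (k Y * B w' β₀ (Y p)) * (τ + (if Z (Y j) then a else 0)) ≤
          (k Y * B w' β₀ (Y p)) * (τ + ((if Near (Y p) then 0 else a) + (if Far (Y p) (Y j) then a else 0))) :=
        mul_le_mul_of_nonneg_left (add_le_add le_rfl h1) hkB
      refine h2.trans (le_of_eq ?_)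
      by_cases hn : Near (Y p) <;> by_cases hf : Far (Y p) (Y j) <;> simp [hn, hf] <;> ring
    refine (sum_le_sum fun Y _ => hsplit Y).trans ?_
    rw [← mul_sum, sum_add_distrib, sum_add_distrib, sum_add_distrib, ← mul_sum, ← mul_sum, ← mul_sum]
    refine mul_le_mul_of_nonneg_left (add_le_add (add_le_add (add_le_add ?_ ?_) ?_) ?_) (pow_nonneg ha _)
    · rw [mul_assoc]
      refine mul_le_mul_of_nonneg_left ?_ hτ0
      exact (sum_mul_apply_leg_le k (fun y => B w' β₀ y) (fun y => hB _ _ _) p hN).trans (mul_le_mul_of_nonneg_right hρ hN0)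
    · have h := sum_mul_apply_leg_le k (fun y => B w' β₀ y * (if Near y then 0 else a))
        (fun y => mul_nonneg (hB _ _ _) (by split_ifs <;> [exact le_rfl; exact ha])) p hN
      refine h.trans ?_
      have hsum : ∑ y, B w' β₀ y * (if Near y then (0 : ℝ) else a) = a * ∑ y ∈ univ.filter (fun y : Γ₁ => ¬ Near y), B w' β₀ y := by
        rw [sum_filter, mul_sum]
        exact sum_congr rfl fun y _ => by by_cases h : Near y <;> simp [h, mul_comm]
      rw [hsum]
      exact mul_le_mul_of_nonneg_right (mul_le_mul_of_nonneg_left hτ₃ ha) hN0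
    · rw [mul_assoc]
      refine mul_le_mul_of_nonneg_left ?_ ha
      have h := sum_mul_apply_leg_le (fun Y => if Far (Y p) (Y j) then k Y else 0) (fun y => B w' β₀ y)
        (fun y => hB _ _ _) p (N := Nfar) ?_
      · exact h.trans (mul_le_mul_of_nonneg_right hρ hNfar0)
      · intro y
        rw [← sum_filter, filter_filter]
        exact hNfar y j
    · rw [mul_assoc]
      refine mul_le_mul_of_nonneg_left ?_ ha
      have h := sum_mul_apply_leg_le k (fun y => ∑ b ∈ univ.erase β₀, B w' b y) (fun y => sum_nonneg fun b _ => hB _ _ _) p hN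
      have hout : ∑ y, ∑ b ∈ univ.erase β₀, B w' b y ≤ τ := by rw [sum_comm]; exact hτ₂
      exact h.trans (mul_le_mul_of_nonneg_right hout hN0)
  -- assemble: split the offending-leg sum at `j = p`
  refine step1.trans ?_
  simp_rw [step2, step3]
  rw [← add_sum_erase univ _ (mem_univ p)]
  refine add_le_add ?_ ?_
  · exact (sum_le_sum fun Y _ => mul_le_mul_of_nonneg_left (step4a Y) (hk Y)).trans step5a
  · calc ∑ j ∈ univ.erase p, ∑ Y : Fin (n + 1) → Γ₁, k Y *
            ((∑ b ∈ (if p = j then univ.erase β₀ else univ), B w' b (Y p)) *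
              ∏ i ∈ univ.erase p, ∑ b ∈ (if i = j then univ.erase β₀ else univ), G b (Y i))
        ≤ ∑ j ∈ univ.erase p, ∑ Y : Fin (n + 1) → Γ₁, k Y *
            ((B w' β₀ (Y p) * (τ + (if Z (Y j) then a else 0)) + (∑ b ∈ univ.erase β₀, B w' b (Y p)) * a) *
              a ^ ((univ.erase p).erase j).card) :=
          sum_le_sum fun j hj => sum_le_sum fun Y _ => mul_le_mul_of_nonneg_left (step4b j hj Y) (hk Y)
      _ ≤ ∑ j ∈ univ.erase p, a ^ ((univ.erase p).erase j).card * (τ * a * N + a * τ * N + a * a * Nfar + a * τ * N) :=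
          sum_le_sum fun j hj => step5b j hj
      _ = ∑ _j ∈ univ.erase p, a ^ n * (3 * τ * N + a * Nfar) := by
          refine sum_congr rfl fun j hj => ?_
          have hc : a ^ ((univ.erase p).erase j).card * a = a ^ n := by
            rw [← pow_succ, card_univ_erase_erase_fin hj]
          rw [← hc]
          ring
      _ = n * a ^ n * (3 * τ * N + a * Nfar) := by rw [sum_const, card_univ_erase_fin, nsmul_eq_mul]; ring


end Generic

end Summit.HubbardSuperconductivity.HubbardSuperconductivity.Theorems.TwoVolumeDefect

end
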